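import Mathlib
import Literature.NumberTheory.Transcendental.PeriodsWave0
import HarnessLib

/-!
# Distribution of irrational zeta values (Fischler 2017)

Topic `Literature/NumberTheory/Irrationality/Fischler2017`. Typed, cited statements (no proofs) of the theorems of
S. Fischler, *Distribution of irrational zeta values*, Bull. Soc. Math. France **145**:3 (2017) 381–409 =
arXiv:1310.1685 [Fischler2017Distribution]. READ ON THE PAGE: held text `paper:arxiv-1310.1685` (§1 = chunks
p0003–p0004, §4.2–4.4 = p0014–p0015), every display transcribed from the arXiv LaTeX source
(`nestsev_galise_HALv1.tex`, lines 343–414; the numerical macros `\cstun = 6·10⁻⁶`, l. 271). Numbering is that of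
the arXiv version (Theorems 1.3, 1.5, 1.7, Corollaries 1.4, 1.6, 1.8); the journal version was not re-read
(paywalled) — recorded, not guessed.

Context (§1): Theorem 1.1 = Ball–Rivoal (tree: `Literature.NumberTheory.Transcendental.ball_rivoal`); Theorem 1.2 =
Zudilin's window `ζ(d+2), …, ζ(8d−1)` (tree: `Literature.NumberTheory.Irrationality.Zudilin2002.theorem2`). The new
results say that provably irrational / linearly independent odd zeta values are WELL DISTRIBUTED:

* `theorem13` — **Theorem 1.3**: "Let `ε > 0`, and `a ≥ d ≥ 1` be such that `0 < ε ≤ 1/20` and `a ≥ ε^{−12/ε} d`.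
  Then there exist odd integers `σ_1, …, σ_N` between `d` and `a`, with `N = [(1−ε)/(1+log 2) · log(a/d)]`, such
  that: 1, `ζ(σ_1)`, …, `ζ(σ_N)` are linearly independent over the rationals; for any `i ≠ j`, `|σ_i − σ_j| > d`."
  (`a`, `d` real — "Taking `d = a^ε` …"; "between `d` and `a`" typed as `d < σ_i ≤ a`, the form established in the
  proof, §4.2: "we may assume that `D < σ_i ≤ a+b−1 ≤ A`".)
* `corollary14` — **Corollary 1.4**: `ε > 0`; `a ≥ 3`, `d ≥ 1` odd with `a/d` sufficiently large:
  `dim_ℚ Span_ℚ(ζ(d), ζ(d+2), …, ζ(a)) ≥ (1−ε)log(a/d)/(1+log 2)` (for `d = 1` the printed list starts with the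
  meaningless `ζ(1)`; the tree's `zetaValue 1` is the junk value of a divergent `tsum`, i.e. `0`, which does not
  change the span).
* `theorem15` — **Theorem 1.5**: "For any odd integer `d ≥ 1` there exist odd integers `σ₁, σ₂` with
  `d+2 ≤ σ₁ < σ₂ ≤ 151d`, `σ₂ > σ₁ + 6·10⁻⁶ d`, such that 1, `ζ(σ₁)` and `ζ(σ₂)` are `ℚ`-linearly independent."
  and `dim_three` — the remark closing §4.4: `dim_ℚ Span_ℚ(1, ζ(d+2), ζ(d+4), …, ζ(150d−1)) ≥ 3` for any (odd)
  `d ≥ 1` (records for `d = 1`: 169 Ball–Rivoal, 145 Zudilin, 139 Fischler–Zudilin = tree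
  `FischlerZudilin2010.oddZetaDim139`).
* `corollary16` — **Corollary 1.6** (first three items): for `0 < ε ≤ 1/20`, `η = ε^{15/ε}`, there is an
  increasing sequence of odd integers `u_1 < u_2 < ⋯` with `ζ(u_i) ∉ ℚ`, `u_{i+1}/u_i > 1 + η` and
  `η(2e)^{(1+ε)i} < u_i < η^{−1}(2e)^{(1+ε)i}`. (The fourth item, "for any `a ≥ η^{−1/ε}` we have `s_N ≤ a`",
  refers to an undefined `s_N` — presumably `u_N` — and is NOT typed.)
* `theorem17` — **Theorem 1.7**: `ε, a, d` as in Theorem 1.3 (`d` an integer here), `λ_0, …, λ_d` real, not all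
  zero: the numbers `λ_0ζ(s) + λ_1 C(s+1,2)ζ(s+2) + λ_2 C(s+3,4)ζ(s+4) + ⋯ + λ_d C(s+2d−1,2d)ζ(s+2d)`, `s` odd
  between `d` and `a` (typed `d ≤ s ≤ a`, the larger index set), span a `ℚ`-vector space of dimension at least
  `[(1−ε)/(1+log 2) · log(a/d)]`; `corollary18` — **Corollary 1.8**: for `d ≥ 1` and `λ` not all zero that number
  is irrational for infinitely many odd `s`.

`ζ(k) = zetaValue k` (tree, `PeriodsWave0`). All six are named facts (statements only; proofs: Nesterenko's
criterion for vectors [SFnestsev] + the saddle-point method on the forms (1.3) of §1). NOT typed: the Diophantine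
Theorem 3.1 and the linear-algebra Proposition 4.1 behind them. WHAT THIS IS NOT: nothing here isolates `ζ(5)`;
cell zeta5-irr reads these as RECORD/structure statements only.
-/

noncomputable section

open Finset

namespace Literature.NumberTheory.Irrationality.Fischler2017

open Literature.NumberTheory.Transcendental (zetaValue)

/-- `N(ε; x) = [(1−ε)/(1+log 2) · log x]` (integer part), the counting function of Theorems 1.3 and 1.7
(with `x = a/d`). [cite: Fischler2017Distribution, Theorem 1.3] -/
def count (ε x : ℝ) : ℕ := ⌊(1 - ε) / (1 + Real.log 2) * Real.log x⌋₊

/-- **Theorem 1.3** (Fischler): for `0 < ε ≤ 1/20` and real `a ≥ d ≥ 1` with `a ≥ ε^{−12/ε} d` there are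
`N = [(1−ε)/(1+log 2)·log(a/d)]` odd integers `σ_i` with `d < σ_i ≤ a`, pairwise at distance `> d`, such that
`1, ζ(σ_1), …, ζ(σ_N)` are linearly independent over `ℚ`. Named fact (statement only).
[cite: Fischler2017Distribution, Theorem 1.3 (and §4.2, "D < σ_i ≤ a+b−1 ≤ A")] -/
def theorem13 : Prop :=
  ∀ ε a d : ℝ, 0 < ε → ε ≤ 1 / 20 → 1 ≤ d → d ≤ a → ε ^ (-12 / ε) * d ≤ a →
    ∃ σ : Fin (count ε (a / d)) → ℕ,
      (∀ i, Odd (σ i) ∧ d < σ i ∧ (σ i : ℝ) ≤ a) ∧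
        (∀ i j, i ≠ j → d < |(σ i : ℝ) - σ j|) ∧
          LinearIndependent ℚ (Fin.cons (1 : ℝ) fun i => zetaValue (σ i))

/-- **Corollary 1.4** (Fischler): for `ε > 0` and odd integers `a ≥ 3`, `d ≥ 1` with `a/d` sufficiently large
(in terms of `ε`), `dim_ℚ Span_ℚ(ζ(d), ζ(d+2), …, ζ(a)) ≥ (1−ε)log(a/d)/(1+log 2)`. Named fact (statement only).
[cite: Fischler2017Distribution, Corollary 1.4] -/
def corollary14 : Prop :=
  ∀ ε : ℝ, 0 < ε → ∃ C : ℝ, ∀ a d : ℕ, Odd a → Odd d → 3 ≤ a → 1 ≤ d → C ≤ (a : ℝ) / d →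
    (1 - ε) * Real.log ((a : ℝ) / d) / (1 + Real.log 2) ≤
      Module.finrank ℚ
        ↥(Submodule.span ℚ {x : ℝ | ∃ k : ℕ, Odd k ∧ d ≤ k ∧ k ≤ a ∧ x = zetaValue k})

/-- **Theorem 1.5** (Fischler): for every odd `d ≥ 1` there are odd `σ₁, σ₂` with `d + 2 ≤ σ₁ < σ₂ ≤ 151d` and
`σ₂ > σ₁ + 6·10⁻⁶·d` such that `1, ζ(σ₁), ζ(σ₂)` are `ℚ`-linearly independent. Named fact (statement only).
[cite: Fischler2017Distribution, Theorem 1.5] -/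
def theorem15 : Prop :=
  ∀ d : ℕ, Odd d → ∃ σ₁ σ₂ : ℕ, Odd σ₁ ∧ Odd σ₂ ∧ d + 2 ≤ σ₁ ∧ σ₁ < σ₂ ∧ σ₂ ≤ 151 * d ∧
    (σ₁ : ℝ) + 6 / 10 ^ 6 * d < σ₂ ∧
      LinearIndependent ℚ ![(1 : ℝ), zetaValue σ₁, zetaValue σ₂]

/-- The remark closing §4.4: `dim_ℚ Span_ℚ(1, ζ(d+2), ζ(d+4), …, ζ(150d−1)) ≥ 3` for every odd `d ≥ 1`
("taking `b = d` and `t = 1`, the proof yields"). Named fact (statement only).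
[cite: Fischler2017Distribution, §4.4 (display before "On the other hand")] -/
def dim_three : Prop :=
  ∀ d : ℕ, Odd d → 3 ≤ Module.finrank ℚ
    ↥(Submodule.span ℚ (insert (1 : ℝ) {x : ℝ | ∃ k : ℕ, Odd k ∧ d + 2 ≤ k ∧ k ≤ 150 * d - 1 ∧ x = zetaValue k}))

/-- **Corollary 1.6** (Fischler; first three items): for `0 < ε ≤ 1/20`, `η = ε^{15/ε}`, there is an increasing
sequence `u_1 < u_2 < ⋯` of odd integers (here `u (i−1)` is the paper's `u_i`) with `ζ(u_i) ∉ ℚ`,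
`u_{i+1}/u_i > 1 + η`, and `η(2e)^{(1+ε)i} < u_i < η^{−1}(2e)^{(1+ε)i}` for all `i ≥ 1`. Named fact
(statement only; the fourth printed item is not typed, see the module docstring).
[cite: Fischler2017Distribution, Corollary 1.6] -/
def corollary16 : Prop :=
  ∀ ε : ℝ, 0 < ε → ε ≤ 1 / 20 →
    ∃ u : ℕ → ℕ, StrictMono u ∧ (∀ i, Odd (u i)) ∧ (∀ i, Irrational (zetaValue (u i))) ∧
      (∀ i, (1 + ε ^ (15 / ε)) * u i < u (i + 1)) ∧
        ∀ i, ε ^ (15 / ε) * (2 * Real.exp 1) ^ ((1 + ε) * (i + 1 : ℕ)) < u i ∧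
          (u i : ℝ) < (ε ^ (15 / ε))⁻¹ * (2 * Real.exp 1) ^ ((1 + ε) * (i + 1 : ℕ))

/-- The numbers (1.2) of Theorem 1.7:
`λ_0 ζ(s) + λ_1 C(s+1,2) ζ(s+2) + λ_2 C(s+3,4) ζ(s+4) + ⋯ + λ_d C(s+2d−1,2d) ζ(s+2d)`.
[cite: Fischler2017Distribution, Theorem 1.7 eq. (1.2)] -/
def combination (d : ℕ) (l : ℕ → ℝ) (s : ℕ) : ℝ :=
  l 0 * zetaValue s + ∑ j ∈ Icc 1 d, l j * (Nat.choose (s + 2 * j - 1) (2 * j) : ℝ) * zetaValue (s + 2 * j)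

/-- **Theorem 1.7** (Fischler): with `ε, a, d` as in Theorem 1.3 (`d` a positive integer) and real `λ_0, …, λ_d`
not all zero, the numbers (1.2) for odd `s` between `d` and `a` span a `ℚ`-vector space of dimension at least
`[(1−ε)/(1+log 2)·log(a/d)]`. Named fact (statement only). [cite: Fischler2017Distribution, Theorem 1.7] -/
def theorem17 : Prop :=
  ∀ (ε a : ℝ) (d : ℕ) (l : ℕ → ℝ), 0 < ε → ε ≤ 1 / 20 → 1 ≤ d → (d : ℝ) ≤ a → ε ^ (-12 / ε) * d ≤ a →
    (∃ j, j ≤ d ∧ l j ≠ 0) →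
      (count ε (a / d) : ℝ) ≤
        Module.finrank ℚ
          ↥(Submodule.span ℚ {x : ℝ | ∃ s : ℕ, Odd s ∧ d ≤ s ∧ (s : ℝ) ≤ a ∧ x = combination d l s})

/-- **Corollary 1.8** (Fischler): for `d ≥ 1` and real `λ_0, …, λ_d` not all zero, the number (1.2) is irrational
for infinitely many odd integers `s`. Named fact (statement only). [cite: Fischler2017Distribution, Corollary 1.8] -/
def corollary18 : Prop :=
  ∀ (d : ℕ) (l : ℕ → ℝ), 1 ≤ d → (∃ j, j ≤ d ∧ l j ≠ 0) →
    {s : ℕ | Odd s ∧ Irrational (combination d l s)}.Infinite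

/-- Sanity: at `λ = (1, 0, …, 0)` the number (1.2) is `ζ(s)` itself, so Corollary 1.8 contains "infinitely many
odd zeta values are irrational" (Ball–Rivoal; tree `infinite_setOf_irrational_zetaValue_odd`).
[cite: Fischler2017Distribution, Corollary 1.8] -/
theorem combination_single (d s : ℕ) : combination d (fun j => if j = 0 then 1 else 0) s = zetaValue s := by
  unfold combination
  have h0 : ∑ j ∈ Icc 1 d, (fun j : ℕ => if j = 0 then (1 : ℝ) else 0) j *
      (Nat.choose (s + 2 * j - 1) (2 * j) : ℝ) * zetaValue (s + 2 * j) = 0 := by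
    refine sum_eq_zero fun j hj => ?_
    have hj1 : j ≠ 0 := by have := (mem_Icc.mp hj).1; omega
    simp [hj1]
  rw [h0]
  simp

end Literature.NumberTheory.Irrationality.Fischler2017
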